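/-
Copyright (c) 2026 the pub-hodgecm-mathlib formalisation cell (harness21).  Prover seat hodgecm-mathlib-K2Liu-p26 (g2): Track B «K2-LIT»,
#184♮ = hLiu418 = stmt-HodgeConjecture-24832; #42S organ S1, (G) organ ROW (ρ-mid), step (M2a-C3-e): THE BLOCK READING OF THE INTEGRATION POINT of
★ (C2b′)∕★ (C3) (`K2LiuTensorMiddleCellHaarDelta`, `K2LiuTensorMiddleCellLeviRow`) — the `hz` letter of (C3-c) `K2LiuTensorMiddleCellFrameReading`
(K2E1-p10 (g4)) from the MOVER letter `hp₁` alone (LEAD F0P6-plan (g14) BATCH #68 (1) ∕ #78; K2Liu-p26 22:27:39Z «taking (C3-e)»).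
-/
import Summits.HodgeConjecture.HodgeConjecture.Theorems.K2LiuTensorMiddleCellHaarDelta     -- ★ (C2b′): the frame `PD`, Kudla's `j̃(p₁,p₂)`, all local letters
import Literature.NumberTheory.GelbartRogawski1991.LocalDoubledRationalFrameModels        -- ★ `resL_resR_frameLin_pd` (the `e₂`-halves of `PD·u`)
import Mathlib.Topology.Algebra.Module.ModuleTopology
import Mathlib.Data.Matrix.PEquiv
import HarnessLib

/-!
# Crux `HLiu418`, #42S organ S1, (G) organ ROW (ρ-mid), step (M2a-C3-e): THE BLOCK READING OF THE INTEGRATION POINT —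
# `halfDiff(e_D⁻¹(E′⁻¹(PD·(x₁ ⊔ 0), 0)))_{(j,l)} = [j = i₀] · cX(x₁)_l` with `cX : X₁ ≃L[F_v] (E ⊗ F_v)^{M₂}`, from the mover letter of `p₁` ALONE

Cell `hodgecm-mathlib`, crux item hLiu418 = `stmt-HodgeConjecture-24832`, route of record `HCCMUnconditional`; squad K2 ∕ K2Liu, road `K2_Liu`, socket #42S (a),
organ S1; LEAD F0P6-plan (g14); (M2a) chain: ★ (C1) p861833 → ★ (C2a∕C2b′) p862139 → ★ (C3) p862499 `K2LiuTensorMiddleCellLeviRow` (this seat) → (C3-b) ★ p862528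
(K2Liu-p23 (g2)) ∕ (C3-c) `K2LiuTensorMiddleCellFrameReading` (K2E1-p10 (g4)) ∕ (C3-d) (K2Liu-p08 (g5)) → evaluation (F0P2-p07 (g0) 📤 p862456, K2Liu-p08).
THEOREMS ONLY (no `def`, no `instance`, no `notation`, no named-fact hypothesis, no `sorry`); lane `--supports stmt-HodgeConjecture-24832` (count-neutral helper).

WHY.  The Levi row ★ (C3) `exists_ne_zero_swSectionTensorLoc_flip_mul_nElem_mul_eq_integral_levi` reads the witness `Γ′Ψ` at the point `B⁻¹ · PD · (x₁ ⊔ 0)`,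
`x₁ ∈ X₁`, and (C3-c) turns `κ(B⁻¹ · z)` into a Levi row `(α·a, β·a, γ·a)` GIVEN the letter `hz : (κ z).1 = α • e_{i₀}, (κ z).2.1 = β • e_{i₀}, (κ z).2.2 = γ • e_{i₀}`
for `z := PD · (x₁ ⊔ 0)`.  THIS FILE computes the (K1)-reading `R z j l = halfDiff(e_D⁻¹(E′⁻¹(z, 0))) (epsV (j, l))` of that point for the implementer of record
`E′ := π(frameMp_{PD} j̃(p₁, p₂))`, from the MOVER letter `hp₁ : π(p₁) ℓ_Δ = ℓ_Y` alone (no Cayley letter, no (C2c)):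
`E′⁻¹(PD·(x₁ ⊔ 0), 0) = frameW_{PD}(u.1 ⊔ 0, u.2 ⊔ 0)` with `u := π(p₁)⁻¹(x₁, 0) ∈ 𝕎^𝔻_{T₁}` (§3: `π(j̃) = spInl π(p₁) · spInr π(p₂)` and `π(p₂)` fixes `0`), the frame
`PD = P ⊕ P` acts on `halfDiff ∘ e_D⁻¹` by the permutation matrix `P` (§1 `halfDiff_eD_symm_frameW_pd`), the block point `(u.1 ⊔ 0, u.2 ⊔ 0)` reads
`halfDiff(e_D⁻¹ u) ⊔ 0` (§1 `halfDiff_eD_symm_glue`), and `σ (epsV (i₀, l)) = inl l`, `σ (epsV (i₁, l)) = inr l` (the block permutation of ★ (M1)); finally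
`x₁ ↦ halfDiff(e_D⁻¹(π(p₁)⁻¹(x₁, 0)))` is an `F_v`-linear HOMEOMORPHISM `X₁ ≃L (E ⊗ F_v)^{M₂}` because its kernel is `X₁ ∩ π(p₁) ℓ_Δ = X₁ ∩ ℓ_Y = 0` (§2
`exists_moverReading`, ★ `map_eD_deltaV` + `hp₁` + dimension count `2·M₂`; continuity from the module topology ★ `quadraticLocalEquiv`).
* §1 `eD_symm_apply`, `halfDiff_eD_symm_apply`, **`halfDiff_eD_symm_frameW_pd`**, **`halfDiff_eD_symm_glue`**, `halfDiff_eD_symm_zero` (generic doubled datum).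
* §2 **`exists_moverReading`** — for any `a ∈ Sp(𝕎^𝔻_{T₀})` with `a ℓ_Δ = ℓ_Y`: `∃ cX : X ≃L[F_v] (Fin n → E ⊗ F_v), ∀ x, cX x = halfDiff(e_D⁻¹(a⁻¹(x, 0)))`.
* §3 **`toLin_inv_frameMp_boxLoc_apply`** (the point through `E′⁻¹`) and the head **`exists_pointReading`**: with ★ (C2b′)'s frame letters `hi hσ₀ hσ₁ P hPσ hP hPD`
  and the mover `p₁` (`hp₁`), any `p₂`:
  `∃ cX, ∀ x₁ j l, halfDiff(e_D⁻¹(E′⁻¹(PD·(x₁ ⊔ 0), 0))) (epsV (j, l)) = if j = i₀ then cX x₁ l else 0` — row `i₀` = `cX x₁`, row `i₁` = `0`.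
CONSUMER ((C3-c), K2E1-p10): with the witness letter (K1) `![(κ z).1 j, (κ z).2.1 j, (κ z).2.2 j] ᵥ* P₃ = fun l => R z j l (w₀)`, the three rows of `κ z` are
`((cX x₁ · ) (w₀) ᵥ* P₃⁻¹)_b • Pi.single i₀ 1` — the `hz` letter with `(α, β, γ) := ((fun l => cX x₁ l w₀) ᵥ* P₃⁻¹)`; the evaluators change variables along `cX`.
References: [Kudla1994] §2, §3 Thm. 3.1; [MoeglinVignerasWaldspurger1987] Chap. 2 II.1 Rem. (6), II Remarque (3); [HarrisKudlaSweet1996] §1 (1.11); [Weil1964] n° 34;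
[CasselsFrohlichANT1967] Ch. II §10.
HONEST LABEL.  Count-neutral helper; it retires nothing by itself: `HC_CM` is proved only modulo the 7 printed citations (2 remaining named inputs:
hLiu418 = `stmt-HodgeConjecture-24832`, h413 = `stmt-HodgeConjecture-24833`) until rung 0 closes.

## References
* [Kudla1994] S. S. Kudla, *Splitting metaplectic covers of dual reductive pairs*, Israel J. Math. 87 (1994), §2, §3 Thm. 3.1.
* [MoeglinVignerasWaldspurger1987] C. Mœglin, M.-F. Vignéras, J.-L. Waldspurger, LNM 1291 (1987), Chap. 2 II.1 Rem. (6), II Remarque (3).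
* [HarrisKudlaSweet1996] M. Harris, S. Kudla, W. J. Sweet, J. Amer. Math. Soc. 9 (1996), §1 (1.11).
* [Weil1964] A. Weil, Acta Math. 111 (1964), n° 34.
* [CasselsFrohlichANT1967] J. W. S. Cassels, A. Fröhlich (eds.), *Algebraic Number Theory* (1967), Ch. II §10.
-/

set_option autoImplicit false
set_option linter.dupNamespace false -- the mandated namespace repeats `HodgeConjecture.HodgeConjecture`

noncomputable section

open scoped Matrix
open NumberField IsDedekindDomain Matrix
open Literature.RepresentationTheory.HeisenbergGroup Literature.RepresentationTheory.HeisenbergGroup.SymplecticMatrix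
open Literature.NumberTheory.Automorphic Literature.NumberTheory.Automorphic.UnitaryGroup Literature.NumberTheory.Weil1964
open Literature.NumberTheory.GaloisRepresentations Literature.NumberTheory.GaloisRepresentations.IsNonarchimedeanLocalField
open Literature.NumberTheory.GelbartRogawski1991 Literature.NumberTheory.GelbartRogawski1991.GRConstruction
open Literature.NumberTheory.GelbartRogawski1991.AdaptedBlocks
open Literature.NumberTheory.GelbartRogawski1991.UnitaryDualPair
open Literature.NumberTheory.GelbartRogawski1991.UnitaryDualPair.LocalSplitting
open Literature.NumberTheory.GelbartRogawski1991.UnitaryDualPair.LocalSplitting.FrameTransport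
open Literature.NumberTheory.GelbartRogawski1991.UnitaryDualPair.LocalSplitting.DoubledBlock
open Literature.NumberTheory.K2Lit.SiegelDoubled
open Summit.HodgeConjecture.HodgeConjecture.Cruxes.HLiu418.K2LiuLocalSWTensorBlockTransport

namespace Summit.HodgeConjecture.HodgeConjecture.Cruxes.HLiu418.K2LiuTensorMiddleCellPointReading

/-! ## §1 `halfDiff ∘ e_D⁻¹` under the doubled frame `PD = P ⊕ P` and on block points (generic doubled datum) -/

section Generic

variable (F : Type) [Field F] [NumberField F] (E : Type) [Field E] [NumberField E] [Algebra F E] [Algebra.IsQuadraticExtension F E]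
  (c : E ≃ₐ[F] E) {δ : E} (hcδ : c δ = -δ) (hδ : δ ≠ 0) {d : F} (hd : δ * δ = algebraMap F E d)
  (v : HeightOneSpectrum (𝓞 F))

/-- **`e_D⁻¹` in coordinates**: `(e_D⁻¹ (x, y))(s) = ι_v(x (e₂ s)) + ι_v(y (e₂ s)) · δ̂` — the frame `e_D u = reIm (u ∘ e₂⁻¹)` read backwards.
[cite: HarrisKudlaSweet1996, §1 (1.11)] [cite: CasselsFrohlichANT1967, Ch. II §10] -/
theorem eD_symm_apply (n : ℕ) (w : (Fin (n + n) → v.adicCompletion F) × (Fin (n + n) → v.adicCompletion F)) (s : Fin n ⊕ Fin n) :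
    (eD F E c hcδ hδ hd v n).symm w s =
      UnitaryGroup.toLocalRing E v (w.1 (e₂ n s)) + UnitaryGroup.toLocalRing E v (w.2 (e₂ n s)) * algebraMap E (LocalRing E v) δ := by
  -- `e_D` applied to the candidate preimage is `w`
  have key : eD F E c hcδ hδ hd v n (fun s => quadraticLocalEquiv E v c hcδ hδ (w.1 (e₂ n s), w.2 (e₂ n s))) = w := by
    rw [eD_apply]
    refine Prod.ext (funext fun k => ?_) (funext fun k => ?_)
    · simp only [localReImD, QuadraticCoordinates.reIm_apply_fst, Function.comp_apply, Equiv.apply_symm_apply]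
      exact QuadraticCoordinates.re_apply _ _ _
    · simp only [localReImD, QuadraticCoordinates.reIm_apply_snd, Function.comp_apply, Equiv.apply_symm_apply]
      exact QuadraticCoordinates.im_apply _ _ _
  have h := congrArg (eD F E c hcδ hδ hd v n).symm key
  rw [LinearEquiv.symm_apply_apply] at h
  rw [← h]
  dsimp only
  rw [quadraticLocalEquiv_apply]

/-- **`halfDiff ∘ e_D⁻¹` in coordinates**: the `Δ⁻`-coordinate `i` of `(x, y)` is `½(ι_v(x_{inl i} − x_{inr i}) + ι_v(y_{inl i} − y_{inr i}) · δ̂)`.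
[cite: HarrisKudlaSweet1996, §1 (1.11)] -/
theorem halfDiff_eD_symm_apply (n : ℕ) (w : (Fin (n + n) → v.adicCompletion F) × (Fin (n + n) → v.adicCompletion F)) (i : Fin n) :
    halfDiff ((eD F E c hcδ hδ hd v n).symm w) i =
      ⅟(2 : LocalRing E v) *
        ((UnitaryGroup.toLocalRing E v (w.1 (e₂ n (Sum.inl i))) - UnitaryGroup.toLocalRing E v (w.1 (e₂ n (Sum.inr i)))) +
          (UnitaryGroup.toLocalRing E v (w.2 (e₂ n (Sum.inl i))) - UnitaryGroup.toLocalRing E v (w.2 (e₂ n (Sum.inr i)))) *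
            algebraMap E (LocalRing E v) δ) := by
  rw [halfDiff, Pi.smul_apply, Pi.sub_apply, Function.comp_apply, Function.comp_apply, eD_symm_apply, eD_symm_apply, smul_eq_mul]
  ring

/-- `halfDiff (e_D⁻¹ 0) = 0`. [folklore] -/
theorem halfDiff_eD_symm_zero (n : ℕ) :
    halfDiff ((eD F E c hcδ hδ hd v n).symm 0) = 0 := by
  funext i
  rw [halfDiff_eD_symm_apply]
  simp only [Prod.fst_zero, Prod.snd_zero, Pi.zero_apply, map_zero, sub_self, zero_mul, add_zero, mul_zero]

/-- **THE DOUBLED FRAME ACTS ON `halfDiff ∘ e_D⁻¹` BY `P`**: for `PD = P ⊕ P` (`reindexGL e₂ (blockDiagGL (P, P))`) and every `w ∈ 𝕎^𝔻_v`,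
`halfDiff(e_D⁻¹(frameW_{PD} w)) = P · halfDiff(e_D⁻¹ w)` (`P` read over `E ⊗ F_v`; ★ `resL_resR_frameLin_pd`: the `e₂`-halves of `PD·u` are `P·(u|_L)`, `P·(u|_R)`).
[cite: Weil1964, n° 34] [cite: HarrisKudlaSweet1996, §1 (1.11)] -/
theorem halfDiff_eD_symm_frameW_pd (n : ℕ) (P : GL (Fin n) F) {PD : GL (Fin (n + n)) F}
    (hPD : PD = UnitaryGroup.reindexGL (e₂ n) (UnitaryGroup.blockDiagGL (P, P)))
    (w : (Fin (n + n) → v.adicCompletion F) × (Fin (n + n) → v.adicCompletion F)) :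
    halfDiff ((eD F E c hcδ hδ hd v n).symm (frameW F v (n + n) PD w)) =
      ((P : Matrix (Fin n) (Fin n) F).map ((UnitaryGroup.toLocalRing E v).comp (algebraMap F (v.adicCompletion F)))) *ᵥ
        halfDiff ((eD F E c hcδ hδ hd v n).symm w) := by
  funext i
  have h1 := resL_resR_frameLin_pd F v n P hPD w.1
  have h2 := resL_resR_frameLin_pd F v n P hPD w.2
  -- the four coordinates of `frameW_{PD} w` at `e₂ (inl i)`, `e₂ (inr i)`
  have a1 : (frameW F v (n + n) PD w).1 (e₂ n (Sum.inl i)) = ∑ j, algebraMap F (v.adicCompletion F) (P i j) * w.1 (e₂ n (Sum.inl j)) := by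
    have h := congrFun h1.1 i
    simp only [resL, frameLin_apply, Matrix.mulVec, dotProduct, Matrix.map_apply] at h
    rw [frameW_apply]; exact h
  have a2 : (frameW F v (n + n) PD w).1 (e₂ n (Sum.inr i)) = ∑ j, algebraMap F (v.adicCompletion F) (P i j) * w.1 (e₂ n (Sum.inr j)) := by
    have h := congrFun h1.2 i
    simp only [resR, frameLin_apply, Matrix.mulVec, dotProduct, Matrix.map_apply] at h
    rw [frameW_apply]; exact h
  have a3 : (frameW F v (n + n) PD w).2 (e₂ n (Sum.inl i)) = ∑ j, algebraMap F (v.adicCompletion F) (P i j) * w.2 (e₂ n (Sum.inl j)) := by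
    have h := congrFun h2.1 i
    simp only [resL, frameLin_apply, Matrix.mulVec, dotProduct, Matrix.map_apply] at h
    rw [frameW_apply]; exact h
  have a4 : (frameW F v (n + n) PD w).2 (e₂ n (Sum.inr i)) = ∑ j, algebraMap F (v.adicCompletion F) (P i j) * w.2 (e₂ n (Sum.inr j)) := by
    have h := congrFun h2.2 i
    simp only [resR, frameLin_apply, Matrix.mulVec, dotProduct, Matrix.map_apply] at h
    rw [frameW_apply]; exact h
  rw [halfDiff_eD_symm_apply, a1, a2, a3, a4, Matrix.mulVec, dotProduct]
  simp only [map_sum, map_mul, Matrix.map_apply, RingHom.comp_apply, halfDiff_eD_symm_apply]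
  have hj : ∀ j : Fin n,
      UnitaryGroup.toLocalRing E v (algebraMap F (v.adicCompletion F) (P i j)) *
          (⅟(2 : LocalRing E v) *
            ((UnitaryGroup.toLocalRing E v (w.1 (e₂ n (Sum.inl j))) - UnitaryGroup.toLocalRing E v (w.1 (e₂ n (Sum.inr j)))) +
              (UnitaryGroup.toLocalRing E v (w.2 (e₂ n (Sum.inl j))) - UnitaryGroup.toLocalRing E v (w.2 (e₂ n (Sum.inr j)))) *
                algebraMap E (LocalRing E v) δ)) =
        ⅟(2 : LocalRing E v) * (UnitaryGroup.toLocalRing E v (algebraMap F (v.adicCompletion F) (P i j)) * UnitaryGroup.toLocalRing E v (w.1 (e₂ n (Sum.inl j)))) -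
          ⅟(2 : LocalRing E v) * (UnitaryGroup.toLocalRing E v (algebraMap F (v.adicCompletion F) (P i j)) * UnitaryGroup.toLocalRing E v (w.1 (e₂ n (Sum.inr j)))) +
          ⅟(2 : LocalRing E v) * (UnitaryGroup.toLocalRing E v (algebraMap F (v.adicCompletion F) (P i j)) * UnitaryGroup.toLocalRing E v (w.2 (e₂ n (Sum.inl j)))) *
            algebraMap E (LocalRing E v) δ -
          ⅟(2 : LocalRing E v) * (UnitaryGroup.toLocalRing E v (algebraMap F (v.adicCompletion F) (P i j)) * UnitaryGroup.toLocalRing E v (w.2 (e₂ n (Sum.inr j)))) *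
            algebraMap E (LocalRing E v) δ := fun j => by ring
  simp only [hj, Finset.sum_add_distrib, Finset.sum_sub_distrib, ← Finset.mul_sum, ← Finset.sum_mul]
  ring

/-- **BLOCK POINTS READ BLOCKWISE**: `halfDiff(e_D⁻¹(x₁ ⊔ x₂, y₁ ⊔ y₂)) = halfDiff(e_D⁻¹(x₁, y₁)) ⊔ halfDiff(e_D⁻¹(x₂, y₂))` along Kudla's index shuffle
`blkIdx` (`(V₁ ⊕ V₁⁻) ⊕ (V₂ ⊕ V₂⁻) ≃ (V₁ ⊕ V₂) ⊕ (V₁⁻ ⊕ V₂⁻)`) and `finSumFinEquiv` on the `Δ⁻`-coordinates. [cite: Kudla1994, §2]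
[cite: MoeglinVignerasWaldspurger1987, Chap. 2 II.1 Rem. (6)] -/
theorem halfDiff_eD_symm_glue (n₁ n₂ : ℕ) (x₁ y₁ : Fin (n₁ + n₁) → v.adicCompletion F) (x₂ y₂ : Fin (n₂ + n₂) → v.adicCompletion F) :
    halfDiff ((eD F E c hcδ hδ hd v (n₁ + n₂)).symm (glue (blkIdx n₁ n₂) x₁ x₂, glue (blkIdx n₁ n₂) y₁ y₂)) =
      glue finSumFinEquiv (halfDiff ((eD F E c hcδ hδ hd v n₁).symm (x₁, y₁))) (halfDiff ((eD F E c hcδ hδ hd v n₂).symm (x₂, y₂))) := by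
  funext j
  obtain ⟨s, rfl⟩ := finSumFinEquiv.surjective j
  rcases s with k | k
  · rw [glue_apply_inl, halfDiff_eD_symm_apply, halfDiff_eD_symm_apply]
    simp only [← blkIdx_inl_inl, ← blkIdx_inl_inr, glue_apply_inl]
  · rw [glue_apply_inr, halfDiff_eD_symm_apply, halfDiff_eD_symm_apply]
    simp only [← blkIdx_inr_inl, ← blkIdx_inr_inr, glue_apply_inr]

end Generic

/-! ## §2 The mover reading `x ↦ halfDiff(e_D⁻¹(a⁻¹(x, 0)))` is an `F_v`-linear homeomorphism `X ≃L (E ⊗ F_v)^n` -/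

section Mover

variable (F : Type) [Field F] [NumberField F] (E : Type) [Field E] [NumberField E] [Algebra F E] [Algebra.IsQuadraticExtension F E]
  (c : E ≃ₐ[F] E) {δ : E} (hcδ : c δ = -δ) (hδ : δ ≠ 0) {d : F} (hd : δ * δ = algebraMap F E d)
  (v : HeightOneSpectrum (𝓞 F)) (n : ℕ) {T₀ : Matrix (Fin n) (Fin n) F}

/-- **THE MOVER READING IS A LINEAR HOMEOMORPHISM**: if `a ∈ Sp(𝕎^𝔻_v)` carries `ℓ_Δ` onto `ℓ_Y` then `x ↦ halfDiff(e_D⁻¹(a⁻¹(x, 0)))` is an `F_v`-linear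
homeomorphism `X ≃L[F_v] (Fin n → E ⊗ F_v)`: it is injective because `a⁻¹(x, 0) ∈ e_D(Δ ⊗ F_v) = ℓ_Δ` forces `(x, 0) ∈ a ℓ_Δ = ℓ_Y = 0 × Y` (★ `map_eD_deltaV`), both
sides have `F_v`-dimension `2n` (★ `finrank_localRing`), and every linear map between them is continuous for the module topologies (★ `quadraticLocalEquiv`).
[cite: HarrisKudlaSweet1996, §1 (1.11)] [cite: Kudla1994, §3 Thm. 3.1] [cite: CasselsFrohlichANT1967, Ch. II §10] -/
theorem exists_moverReading (a : LocalSp F (n + n) (gramD F n T₀) v)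
    (ha : (deltaLagrangian F v n).map (toLin F v a) = lagrangianY F (n + n) v) :
    ∃ cX : (Fin (n + n) → v.adicCompletion F) ≃L[v.adicCompletion F] (Fin n → LocalRing E v),
      ∀ x : Fin (n + n) → v.adicCompletion F,
        cX x = halfDiff ((eD F E c hcδ hδ hd v n).symm
          (((a : LocalSp F (n + n) (gramD F n T₀) v) : ((Fin (n + n) → v.adicCompletion F) × (Fin (n + n) → v.adicCompletion F)) ≃ₗ[v.adicCompletion F]
            ((Fin (n + n) → v.adicCompletion F) × (Fin (n + n) → v.adicCompletion F))).symm (x, 0))) := by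
  -- abbreviations
  set A : ((Fin (n + n) → v.adicCompletion F) × (Fin (n + n) → v.adicCompletion F)) ≃ₗ[v.adicCompletion F]
      ((Fin (n + n) → v.adicCompletion F) × (Fin (n + n) → v.adicCompletion F)) :=
    ((a : LocalSp F (n + n) (gramD F n T₀) v) : ((Fin (n + n) → v.adicCompletion F) × (Fin (n + n) → v.adicCompletion F)) ≃ₗ[v.adicCompletion F]
      ((Fin (n + n) → v.adicCompletion F) × (Fin (n + n) → v.adicCompletion F))) with hA
  -- `halfDiff` is `F_v`-linear
  have hsmul : ∀ (r : v.adicCompletion F) (u : Fin n ⊕ Fin n → LocalRing E v), halfDiff (r • u) = r • halfDiff u := by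
    intro r u
    funext i
    simp only [halfDiff, Pi.smul_apply, Pi.sub_apply, Function.comp_apply, smul_eq_mul, smul_localRing_def, mul_sub]
    ring
  -- the linear map
  let f : (Fin (n + n) → v.adicCompletion F) →ₗ[v.adicCompletion F] (Fin n → LocalRing E v) :=
    { toFun := fun x => halfDiff ((eD F E c hcδ hδ hd v n).symm (A.symm (x, 0)))
      map_add' := fun x y => by
        have hxy : ((x + y, 0) : (Fin (n + n) → v.adicCompletion F) × (Fin (n + n) → v.adicCompletion F)) = (x, 0) + (y, 0) := by
          rw [Prod.mk_add_mk, add_zero]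
        rw [hxy, map_add, map_add, halfDiff_add]
      map_smul' := fun r x => by
        have hrx : ((r • x, 0) : (Fin (n + n) → v.adicCompletion F) × (Fin (n + n) → v.adicCompletion F)) = r • (x, 0) := by
          rw [Prod.smul_mk, smul_zero]
        rw [hrx, map_smul, map_smul, hsmul, RingHom.id_apply] }
  have hf : ∀ x, f x = halfDiff ((eD F E c hcδ hδ hd v n).symm (A.symm (x, 0))) := fun x => rfl
  -- injectivity: the kernel is `X ∩ a ℓ_Δ = X ∩ ℓ_Y = 0`
  have hinj : Function.Injective f := by
    rw [← LinearMap.ker_eq_bot, LinearMap.ker_eq_bot']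
    intro x hx
    rw [hf] at hx
    -- `e_D⁻¹(a⁻¹(x,0))` is diagonal
    have hmem : (eD F E c hcδ hδ hd v n).symm (A.symm (x, 0)) ∈ deltaV F E v n := by
      rw [mem_deltaV_iff]
      intro i
      have hi := congrFun hx i
      rw [Pi.zero_apply, halfDiff, Pi.smul_apply, Pi.sub_apply, Function.comp_apply, Function.comp_apply, smul_eq_mul] at hi
      -- `⅟2 · (u_inl − u_inr) = 0 ⇒ u_inl = u_inr`
      have h2 := congrArg (fun z => (2 : LocalRing E v) * z) hi
      simp only [← mul_assoc, mul_invOf_self, one_mul, mul_zero] at h2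
      exact sub_eq_zero.1 h2
    -- so `a⁻¹(x,0) ∈ ℓ_Δ`, i.e. `(x,0) ∈ a ℓ_Δ = ℓ_Y`
    have hΔ : A.symm (x, 0) ∈ deltaLagrangian F v n := by
      rw [← map_eD_deltaV F E c hcδ hδ hd v n]
      exact ⟨_, hmem, (eD F E c hcδ hδ hd v n).apply_symm_apply _⟩
    have hY : ((x, 0) : (Fin (n + n) → v.adicCompletion F) × (Fin (n + n) → v.adicCompletion F)) ∈ lagrangianY F (n + n) v := by
      rw [← ha]
      exact ⟨_, hΔ, A.apply_symm_apply _⟩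
    rw [lagrangianY, Submodule.mem_prod, Submodule.mem_bot] at hY
    exact hY.1
  -- dimension count `2n = n · 2`
  haveI : Module.Finite (v.adicCompletion F) (Fin n → LocalRing E v) := inferInstance
  have hdim : Module.finrank (v.adicCompletion F) (Fin (n + n) → v.adicCompletion F) = Module.finrank (v.adicCompletion F) (Fin n → LocalRing E v) := by
    rw [Module.finrank_fin_fun, Module.finrank_pi_fintype (R := v.adicCompletion F)]
    simp only [finrank_localRing E v, Finset.sum_const, Finset.card_univ, Fintype.card_fin, smul_eq_mul]
    omega
  let eL : (Fin (n + n) → v.adicCompletion F) ≃ₗ[v.adicCompletion F] (Fin n → LocalRing E v) := f.linearEquivOfInjective hinj hdim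
  -- module topologies: every linear map is continuous (both ways)
  haveI hMT : IsModuleTopology (v.adicCompletion F) (LocalRing E v) := IsModuleTopology.iso (quadraticLocalEquiv E v c hcδ hδ)
  haveI : IsModuleTopology (v.adicCompletion F) (Fin n → LocalRing E v) := inferInstance
  refine ⟨{ eL with
      continuous_toFun := IsModuleTopology.continuous_of_linearMap eL.toLinearMap
      continuous_invFun := IsModuleTopology.continuous_of_linearMap eL.symm.toLinearMap }, fun x => ?_⟩
  exact (LinearMap.linearEquivOfInjective_apply hinj hdim x).trans (hf x)

end Mover

/-! ## §3 The tensor datum `𝕍 ⊗ V′`: the point `PD · (x₁ ⊔ 0)` through the implementer `E′ = π(frameMp_{PD} j̃(p₁, p₂))` -/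

section Tensor

variable (L : Type) [Field L] [NumberField L] [IsCMField L]
variable {N M : ℕ} (e : Fin N × Fin M ≃ Fin 2)
  (dV : Fin N → L) (hdV : ∀ i, IsCMField.complexConj L (dV i) = dV i)
  (dW : Fin M → L) (hdW : ∀ i, IsCMField.complexConj L (dW i) = dW i)
variable {M₂ M' : ℕ} (eW : Fin M × Fin M₂ ≃ Fin M') (e' : Fin N × Fin M' ≃ Fin (M₂ + M₂))
  (dV' : Fin M₂ → L) (hdV' : ∀ k, IsCMField.complexConj L (dV' k) = dV' k)
  (v : HeightOneSpectrum (𝓞 (Fp L)))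

set_option maxHeartbeats 800000 in -- MEASURED: the default 200000 times out at `isDefEq` in the `rw` (the `MpPsi (localSchrodinger …)` ∕ `frameMp` letters)
/-- **THE INTEGRATION POINT THROUGH `E′⁻¹`**: for `E′ = π(frameMp_{PD} j̃(p₁, p₂)) = frameW_{PD} ∘ (π(p₁) ⊞ π(p₂)) ∘ frameW_{PD}⁻¹`,
`E′⁻¹ (PD · (x₁ ⊔ 0), 0) = frameW_{PD} (u.1 ⊔ 0, u.2 ⊔ 0)` with `u = π(p₁)⁻¹ (x₁, 0)` (★ `proj_frameMp`, ★ `proj_boxLoc`, `π(p₂)` fixes `0`).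
[cite: MoeglinVignerasWaldspurger1987, Chap. 2 II.1 Rem. (6), II Remarque (3)] [cite: Kudla1994, §2] -/
theorem toLin_inv_frameMp_boxLoc_apply {T₁ T₂ : Matrix (Fin M₂) (Fin M₂) (Fp L)} (P : GL (Fin (M₂ + M₂)) (Fp L))
    (hP : ((P : Matrix (Fin (M₂ + M₂)) (Fin (M₂ + M₂)) (Fp L)))ᵀ *
        gramR L e' dV hdV (tensorFrame L dW eW dV') (tensorFrame_real L dW hdW eW dV' hdV') * (P : Matrix _ _ (Fp L)) =
      UnitaryGroup.finSum M₂ M₂ T₁ T₂)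
    {PD : GL (Fin ((M₂ + M₂) + (M₂ + M₂))) (Fp L)} (hPD : PD = UnitaryGroup.reindexGL (e₂ (M₂ + M₂)) (UnitaryGroup.blockDiagGL (P, P)))
    (p₁ : LocalMp (Fp L) (M₂ + M₂) (gramD (Fp L) M₂ T₁) v) (p₂ : LocalMp (Fp L) (M₂ + M₂) (gramD (Fp L) M₂ T₂) v)
    (x₁ : Fin (M₂ + M₂) → v.adicCompletion (Fp L)) :
    toLin (Fp L) v (MpPsi.proj _ (frameMp (Fp L) v ((M₂ + M₂) + (M₂ + M₂)) PD (transpose_pd_mul_gramD_mul_pd (Fp L) (M₂ + M₂) P hP hPD)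
        (boxLoc (Fp L) v M₂ M₂ (T₁ := T₁) (T₂ := T₂) (p₁, p₂))))⁻¹
      (frameLin (Fp L) v ((M₂ + M₂) + (M₂ + M₂)) PD (glue (blkIdx M₂ M₂) x₁ 0), 0) =
    frameW (Fp L) v ((M₂ + M₂) + (M₂ + M₂)) PD
      (glue (blkIdx M₂ M₂)
          (((MpPsi.proj _ p₁ : LocalSp (Fp L) (M₂ + M₂) (gramD (Fp L) M₂ T₁) v) :
              ((Fin (M₂ + M₂) → v.adicCompletion (Fp L)) × (Fin (M₂ + M₂) → v.adicCompletion (Fp L))) ≃ₗ[v.adicCompletion (Fp L)]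
                ((Fin (M₂ + M₂) → v.adicCompletion (Fp L)) × (Fin (M₂ + M₂) → v.adicCompletion (Fp L)))).symm (x₁, 0)).1 0,
        glue (blkIdx M₂ M₂)
          (((MpPsi.proj _ p₁ : LocalSp (Fp L) (M₂ + M₂) (gramD (Fp L) M₂ T₁) v) :
              ((Fin (M₂ + M₂) → v.adicCompletion (Fp L)) × (Fin (M₂ + M₂) → v.adicCompletion (Fp L))) ≃ₗ[v.adicCompletion (Fp L)]
                ((Fin (M₂ + M₂) → v.adicCompletion (Fp L)) × (Fin (M₂ + M₂) → v.adicCompletion (Fp L)))).symm (x₁, 0)).2 0) := by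
  -- `E′⁻¹ w₀ = E′.symm w₀`; flip to `w₀ = E′ (…)` and compute `E′` forwards
  dsimp only [LocalSplitting.toLin]
  rw [LinearEquiv.coe_coe, Subgroup.coe_inv, LinearEquiv.coe_inv, LinearEquiv.symm_apply_eq]
  -- `π(frameMp_{PD} j̃) = frameSp_{PD} (spInl π(p₁) · spInr π(p₂))` (★ rfl lemmas; `simp`, not `rw`: reducible matching on the `LocalMp` letters)
  simp only [proj_frameMp, proj_boxLoc, frameSp, symplecticConj_apply, LinearEquiv.symm_apply_apply]
  -- `(π(p₁) ⊞ π(p₂)) (u.1 ⊔ 0, u.2 ⊔ 0) = (x₁ ⊔ 0, 0 ⊔ 0)` and `frameW_{PD} (x₁ ⊔ 0, 0) = (PD·(x₁ ⊔ 0), 0)`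
  simp only [Subgroup.coe_mul, LinearEquiv.mul_apply, coe_spInl, coe_spInr, inrW_apply_glue, inlW_apply_glue, Prod.mk_zero_zero, map_zero,
    Prod.fst_zero, Prod.snd_zero, Prod.mk.eta, LinearEquiv.apply_symm_apply, glue_zero, frameW_apply]

/-- **(M2a-C3-e) THE BLOCK READING OF THE INTEGRATION POINT.**  With ★ (C2b′)'s frame letters (lines `i₀ ≠ i₁`, block permutation `σ` with `σ (epsV (i₀, k)) = inl k`,
`σ (epsV (i₁, k)) = inr k` and matrix `P`, `Pᵀ·gramR(𝕍⊗V′)·P = T₁ ⊕ᶠ T₂`, `PD = P ⊕ P`), a MOVER `p₁` of the block-`1` datum (`hp₁ : π(p₁) ℓ_Δ = ℓ_Y`) and any `p₂`, there is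
an `F_v`-linear homeomorphism `cX : X₁ ≃L[F_v] (Fin M₂ → E ⊗ F_v)` with, for every `x₁ ∈ X₁`, `j : Fin 2`, `l : Fin M₂`,
`halfDiff(e_D⁻¹(E′⁻¹(PD·(x₁ ⊔ 0), 0))) (epsV (j, l)) = if j = i₀ then cX x₁ l else 0`, `E′ := π(frameMp_{PD} j̃(p₁, p₂))` — row `i₀` of the (K1)-reading is the
`Δ⁻`-coordinate vector of `π(p₁)⁻¹(x₁, 0)`, row `i₁` vanishes.
[cite: Kudla1994, §2, §3 Thm. 3.1] [cite: MoeglinVignerasWaldspurger1987, Chap. 2 II.1 Rem. (6), II Remarque (3)] [cite: HarrisKudlaSweet1996, §1 (1.11)] [cite: Weil1964, n° 34] -/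
theorem exists_pointReading {i₀ i₁ : Fin 2} (hi : i₀ ≠ i₁) {σ : Equiv.Perm (Fin (M₂ + M₂))}
    (hσ₀ : ∀ k, σ (epsV e eW e' (i₀, k)) = finSumFinEquiv (Sum.inl k)) (hσ₁ : ∀ k, σ (epsV e eW e' (i₁, k)) = finSumFinEquiv (Sum.inr k))
    {T₁ T₂ : Matrix (Fin M₂) (Fin M₂) (Fp L)}
    (P : GL (Fin (M₂ + M₂)) (Fp L)) (hPσ : (P : Matrix (Fin (M₂ + M₂)) (Fin (M₂ + M₂)) (Fp L)) = σ.toPEquiv.toMatrix)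
    (hP : ((P : Matrix (Fin (M₂ + M₂)) (Fin (M₂ + M₂)) (Fp L)))ᵀ *
        gramR L e' dV hdV (tensorFrame L dW eW dV') (tensorFrame_real L dW hdW eW dV' hdV') * (P : Matrix _ _ (Fp L)) =
      UnitaryGroup.finSum M₂ M₂ T₁ T₂)
    {PD : GL (Fin ((M₂ + M₂) + (M₂ + M₂))) (Fp L)} (hPD : PD = UnitaryGroup.reindexGL (e₂ (M₂ + M₂)) (UnitaryGroup.blockDiagGL (P, P)))
    (p₁ : LocalMp (Fp L) (M₂ + M₂) (gramD (Fp L) M₂ T₁) v)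
    (hp₁ : (deltaLagrangian (Fp L) v M₂).map (toLin (Fp L) v (MpPsi.proj _ p₁)) = lagrangianY (Fp L) (M₂ + M₂) v)
    (p₂ : LocalMp (Fp L) (M₂ + M₂) (gramD (Fp L) M₂ T₂) v) :
    ∃ cX : (Fin (M₂ + M₂) → v.adicCompletion (Fp L)) ≃L[v.adicCompletion (Fp L)] (Fin M₂ → LocalRing L v),
      ∀ (x₁ : Fin (M₂ + M₂) → v.adicCompletion (Fp L)) (j : Fin 2) (l : Fin M₂),
        halfDiff ((eD (Fp L) L (IsCMField.complexConj L) (complexConj_imagUnit L) (imagUnit_ne_zero L) (imagUnit_mul_self L) v (M₂ + M₂)).symm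
            (toLin (Fp L) v (MpPsi.proj _ (frameMp (Fp L) v ((M₂ + M₂) + (M₂ + M₂)) PD (transpose_pd_mul_gramD_mul_pd (Fp L) (M₂ + M₂) P hP hPD)
                (boxLoc (Fp L) v M₂ M₂ (T₁ := T₁) (T₂ := T₂) (p₁, p₂))))⁻¹
              (frameLin (Fp L) v ((M₂ + M₂) + (M₂ + M₂)) PD (glue (blkIdx M₂ M₂) x₁ 0), 0)))
          (epsV e eW e' (j, l)) =
        if j = i₀ then cX x₁ l else 0 := by
  obtain ⟨cX, hcX⟩ := exists_moverReading (Fp L) L (IsCMField.complexConj L) (complexConj_imagUnit L) (imagUnit_ne_zero L) (imagUnit_mul_self L) v M₂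
    (MpPsi.proj _ p₁) hp₁
  refine ⟨cX, fun x₁ j l => ?_⟩
  rw [toLin_inv_frameMp_boxLoc_apply L dV hdV dW hdW eW e' dV' hdV' v P hP hPD p₁ p₂ x₁,
    halfDiff_eD_symm_frameW_pd (Fp L) L (IsCMField.complexConj L) (complexConj_imagUnit L) (imagUnit_ne_zero L) (imagUnit_mul_self L) v (M₂ + M₂) P hPD,
    halfDiff_eD_symm_glue (Fp L) L (IsCMField.complexConj L) (complexConj_imagUnit L) (imagUnit_ne_zero L) (imagUnit_mul_self L) v M₂ M₂,
    Prod.mk.eta, ← hcX x₁, Prod.mk_zero_zero,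
    halfDiff_eD_symm_zero (Fp L) L (IsCMField.complexConj L) (complexConj_imagUnit L) (imagUnit_ne_zero L) (imagUnit_mul_self L) v M₂,
    hPσ, PEquiv.map_toMatrix, PEquiv.toMatrix_toPEquiv_mulVec, Function.comp_apply]
  by_cases hj : j = i₀
  · rw [if_pos hj, hj, hσ₀, glue_apply_inl]
  · have hj1 : j = i₁ := by omega
    rw [if_neg hj, hj1, hσ₁, glue_apply_inr, Pi.zero_apply]

end Tensor

end Summit.HodgeConjecture.HodgeConjecture.Cruxes.HLiu418.K2LiuTensorMiddleCellPointReading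

end
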